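import Summits.PneNP.PneNP.Theses.Mobius

/-!
# Route Mobius — `Assembly` (stmt-PneNP-1117)

`Assembly := P_bool_eq → NP_bool_eq → LiouvilleInNP → LiouvilleNotInP → PneNP`: rewrite Cook's classes `PNPWave0.P Bool`,
`PNPWave0.NP Bool` into `Classes.P`, `Nondeterministic.NP` by the two model bridges and exhibit the Liouville language
`L_λ = {n | λ(n) = 1}` (binary-coded) as the separating language. Propositional. This file imports only the route file.
-/

set_option linter.dupNamespace false -- `Summit.PneNP.PneNP.…`: summit = sub-problem name (D-0017 single-conjunct layout)

namespace Summit.PneNP.PneNP.Theorems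

/-- **Assembly item of route Mobius (stmt-PneNP-1117)**: `P_bool_eq → NP_bool_eq → LiouvilleInNP → LiouvilleNotInP → PneNP` —
the Liouville language is in `NP` and not in `P`, and the bridges transport this to Cook's classes over `Bool`. [folklore] -/
theorem mobius_assembly_proof : Summit.PneNP.PneNP.Theses.Mobius.Assembly := by
  unfold Summit.PneNP.PneNP.Theses.Mobius.Assembly Summit.PneNP.PneNP.Theses.Mobius.LiouvilleInNP
    Summit.PneNP.PneNP.Theses.Mobius.LiouvilleNotInP
  intro hP hN hIn hOut
  unfold Literature.Computability.Complexity.P_bool_eq at hP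
  unfold Literature.Computability.Complexity.NP_bool_eq at hN
  refine ⟨Computability.encodingNatBool.toLanguage {n : ℕ | ArithmeticFunction.liouville n = 1}, ?_, ?_⟩
  · rw [hN]; exact hIn
  · rw [hP]; exact hOut

end Summit.PneNP.PneNP.Theorems
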